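import Mathlib
import Summits.NavierStokesRegularity.NavierStokesRegularity.Theorems.WakeRatchetTailRatchetDyadicPositivity
import HarnessLib

/-!
# `WakeRatchet.TailRatchet` (stmt-NavierStokesRegularity-21808), door D4′ — Cauchy side:
# LOCAL EXISTENCE of regular solutions of the dyadic lattice in `ℓ^∞_Λ`, with an explicit window

Def-free support lemmas for the aside crux `TailRatchet` (route `WakeRatchet`).  MODEL lattice ODEs only
(the scalar dyadic chain `Ẋₙ = Λⁿ⁻¹ Xₙ₋₁² − Λⁿ Xₙ Xₙ₊₁` of Tao 2016 §1.2 / §4, `m = 1`, any real `Λ > 0`);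
nothing in this file is a statement about the Navier–Stokes equations; stmt-21808 is neither proved nor
refuted here and no stub of skeleton d00b85951d7c is closed.

WHY.  The census of the item lists, on the Cauchy side of door D4′, the «Cauchy theory (maximal regular
non-negative solution in ℓ^∞_Λ)».  In the conjugated variables `Yₙ = Λⁿ Xₙ` the lattice reads
`Ẏₙ = Λ Yₙ₋₁² − Λ⁻¹ Yₙ Yₙ₊₁` — a quadratic vector field WITHOUT unbounded coefficients on the Banach
space `ℓ^∞(ℤ) = (ℤ →ᵇ ℝ)`, bounded by `(Λ+Λ⁻¹)ρ²` and `2(Λ+Λ⁻¹)ρ`-Lipschitz on the ball of radius `ρ`.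
Mathlib's Picard–Lindelöf theorem therefore gives, from every datum with `sup_n Λⁿ|Xₙ(0)| ≤ R`, a
solution of the ℤ-indexed lattice on the explicit two-sided window `|t| < δ`, `δ = 1/((Λ+Λ⁻¹)(R+1)² + 1)`,
regular there (`Λⁿ|Xₙ(t)| ≤ R + 1`): exactly the hypotheses `hlaw` / `hreg` of `typeI_dyadic`,
`dyadic_nonneg`, `regularity_horizon_le` (`…DyadicTypeIRate`, `…DyadicPositivity`).

CONTENTS (all def-free):
* `exists_solution_mem_closedBall` — Mathlib's `IsPicardLindelof.exists_eq_forall_mem_Icc_hasDerivWithinAt`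
  with the (internally available) conclusion that the solution stays in the Picard ball, re-exported.
* `dyadic_local_existence` — LOCAL EXISTENCE with explicit window and regularity bound, any `Λ > 0`.
* `dyadic_local_existence_nonneg` — with non-negative data the local solution is non-negative on `[0, δ)`
  and obeys the type-I frame bound there (`Λ > 1`).

HONEST FRAMING: standard ODE theory (Picard–Lindelöf in a Banach space) applied to a MODEL lattice; the
maximal solution / blow-up alternative, uniqueness packaging, and the remaining inputs (M), (D), (Q) of
door D4′ are NOT addressed; rung 0.
-/

noncomputable section

set_option linter.dupNamespace false

namespace Summit.NavierStokesRegularity.NavierStokesRegularity.Theorems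

namespace WakeRatchetDyadicCauchy

open Set Filter Topology Metric BoundedContinuousFunction
open scoped NNReal
open WakeRatchetDyadicPositivity

/-! ## Picard–Lindelöf with the ball conclusion -/

/-- **Picard–Lindelöf, with confinement.**  Under Mathlib's `IsPicardLindelof f t₀ x₀ a r L K` on
`[tmin, tmax]`, from every `x` with `‖x − x₀‖ ≤ r` there is a solution on `[tmin, tmax]` which moreover
stays in the closed ball `closedBall x₀ a` (this membership is part of Mathlib's construction — the
fixed point lives in the space of `L`-Lipschitz curves through `x` — but is not exported by
`exists_eq_forall_mem_Icc_hasDerivWithinAt`; the proof below is Mathlib's with the extra conclusion).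
[cite: Teschl2012, Thm. 2.2 (Picard–Lindelöf); Mathlib `IsPicardLindelof`] -/
theorem exists_solution_mem_closedBall {E : Type*} [NormedAddCommGroup E] [NormedSpace ℝ E]
    [CompleteSpace E] {f : ℝ → E → E} {tmin tmax : ℝ} {t₀ : Icc tmin tmax} {x₀ x : E}
    {a r L K : ℝ≥0} (hf : IsPicardLindelof f t₀ x₀ a r L K) (hx : x ∈ closedBall x₀ r) :
    ∃ α : ℝ → E, α t₀ = x ∧
      (∀ t ∈ Icc tmin tmax, HasDerivWithinAt α (f t (α t)) (Icc tmin tmax) t) ∧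
      ∀ t, α t ∈ closedBall x₀ a := by
  obtain ⟨α, hα⟩ := ODE.FunSpace.exists_isFixedPt_next hf hx
  refine ⟨α.compProj, ?_, fun t ht => ?_, fun t => α.compProj_mem_closedBall hf.mul_max_le⟩
  · rw [ODE.FunSpace.compProj_val, ← hα, ODE.FunSpace.next_apply₀]
  · apply (ODE.hasDerivWithinAt_picard_Icc t₀.2 hf.continuousOn_uncurry
      α.continuous_compProj.continuousOn (fun _ _ => α.compProj_mem_closedBall hf.mul_max_le)
      x ht).congr_of_mem _ ht
    intro t' ht'
    nth_rw 1 [← hα]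
    rw [ODE.FunSpace.compProj_of_mem ht', ODE.FunSpace.next_apply]

/-! ## Local existence for the dyadic lattice in `ℓ^∞_Λ` -/

/-- **LOCAL EXISTENCE OF REGULAR SOLUTIONS (explicit window).**  Let `Λ > 0`, `R ≥ 0` and let the
datum satisfy `Λⁿ|X⁰ₙ| ≤ R` for all `n ∈ ℤ`.  Put `δ = 1/((Λ + Λ⁻¹)(R+1)² + 1)`.  Then there is
`X : ℤ → ℝ → ℝ` with `Xₙ(0) = X⁰ₙ`, solving `Ẋₙ = Λⁿ⁻¹Xₙ₋₁² − ΛⁿXₙXₙ₊₁` at every shell on the open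
window `(−δ, δ)` (two-sided derivatives), and regular on the closed window: `Λⁿ|Xₙ(t)| ≤ R + 1` for
`|t| ≤ δ`.  (Picard–Lindelöf in `ℓ^∞(ℤ)` for the conjugated field `Yₙ ↦ ΛYₙ₋₁² − Λ⁻¹YₙYₙ₊₁`, which is
bounded by `(Λ+Λ⁻¹)(R+1)²` and `2(Λ+Λ⁻¹)(R+1)`-Lipschitz on the ball of radius `R + 1`.)
[cite: Tao2016AveragedNS, §1.2 (dyadic model), §4 Lemma 4.1 (4.8) with `m = 1`; Teschl2012 Thm. 2.2] -/
theorem dyadic_local_existence {Λ R : ℝ} (hΛ : 0 < Λ) (hR : 0 ≤ R) {X₀ : ℤ → ℝ}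
    (hX₀ : ∀ n : ℤ, |Λ ^ n * X₀ n| ≤ R) :
    ∃ X : ℤ → ℝ → ℝ, (∀ n : ℤ, X n 0 = X₀ n) ∧
      (∀ n : ℤ, ∀ t ∈ Ioo (-(1 / ((Λ + Λ⁻¹) * (R + 1) ^ 2 + 1))) (1 / ((Λ + Λ⁻¹) * (R + 1) ^ 2 + 1)),
        HasDerivAt (X n) (Λ ^ (n - 1) * X (n - 1) t ^ 2 - Λ ^ n * X n t * X (n + 1) t) t) ∧
      (∀ n : ℤ, ∀ t ∈ Icc (-(1 / ((Λ + Λ⁻¹) * (R + 1) ^ 2 + 1))) (1 / ((Λ + Λ⁻¹) * (R + 1) ^ 2 + 1)),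
        |Λ ^ n * X n t| ≤ R + 1) := by
  have hΛne : Λ ≠ 0 := hΛ.ne'
  have hΛi : 0 < Λ⁻¹ := inv_pos.2 hΛ
  set C : ℝ := Λ + Λ⁻¹ with hCdef
  have hC : 0 < C := by positivity
  set ρ : ℝ := R + 1 with hρdef
  have hρ : 0 < ρ := by positivity
  set Lr : ℝ := C * ρ ^ 2 with hLrdef
  have hLr : 0 ≤ Lr := by positivity
  set δ : ℝ := 1 / (Lr + 1) with hδdef
  have hδ : 0 < δ := by positivity
  have hLδ : Lr * δ ≤ 1 := by
    rw [hδdef, mul_one_div, div_le_one (by positivity)]; linarith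
  -- the datum as a point of `ℓ^∞(ℤ)`
  set Y₀ : ℤ →ᵇ ℝ := ofNormedAddCommGroupDiscrete (fun n => Λ ^ n * X₀ n) R
    (fun n => by simpa only [Real.norm_eq_abs] using hX₀ n) with hY₀def
  have hY₀n : ‖Y₀‖ ≤ R := (norm_le hR).2 fun n => by
    simpa only [hY₀def, coe_ofNormedAddCommGroupDiscrete, Real.norm_eq_abs] using hX₀ n
  -- coordinates are bounded by the norm
  have hcoord : ∀ (Y : ℤ →ᵇ ℝ) (k : ℤ), |Y k| ≤ ‖Y‖ := fun Y k => by
    simpa only [Real.norm_eq_abs] using Y.norm_coe_le_norm k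
  -- the conjugated field
  have hFb : ∀ (Y : ℤ →ᵇ ℝ) (n : ℤ),
      ‖Λ * Y (n - 1) ^ 2 - Λ⁻¹ * Y n * Y (n + 1)‖ ≤ C * ‖Y‖ ^ 2 := by
    intro Y n
    rw [Real.norm_eq_abs]
    have h1 := hcoord Y (n - 1)
    have h2 := hcoord Y n
    have h3 := hcoord Y (n + 1)
    have hY := norm_nonneg Y
    have e1 : |Λ * Y (n - 1) ^ 2| ≤ Λ * ‖Y‖ ^ 2 := by
      rw [abs_mul, abs_of_pos hΛ, abs_pow]
      exact mul_le_mul_of_nonneg_left (pow_le_pow_left₀ (abs_nonneg _) h1 2) hΛ.le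
    have e2 : |Λ⁻¹ * Y n * Y (n + 1)| ≤ Λ⁻¹ * ‖Y‖ ^ 2 := by
      rw [abs_mul, abs_mul, abs_of_pos hΛi, mul_assoc, sq]
      exact mul_le_mul_of_nonneg_left (mul_le_mul h2 h3 (abs_nonneg _) hY) hΛi.le
    calc |Λ * Y (n - 1) ^ 2 - Λ⁻¹ * Y n * Y (n + 1)|
        ≤ |Λ * Y (n - 1) ^ 2| + |Λ⁻¹ * Y n * Y (n + 1)| := abs_sub _ _
      _ ≤ Λ * ‖Y‖ ^ 2 + Λ⁻¹ * ‖Y‖ ^ 2 := add_le_add e1 e2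
      _ = C * ‖Y‖ ^ 2 := by rw [hCdef]; ring
  set F : (ℤ →ᵇ ℝ) → (ℤ →ᵇ ℝ) := fun Y =>
    ofNormedAddCommGroupDiscrete (fun n => Λ * Y (n - 1) ^ 2 - Λ⁻¹ * Y n * Y (n + 1))
      (C * ‖Y‖ ^ 2) (hFb Y) with hFdef
  have hFapply : ∀ (Y : ℤ →ᵇ ℝ) (n : ℤ), F Y n = Λ * Y (n - 1) ^ 2 - Λ⁻¹ * Y n * Y (n + 1) :=
    fun Y n => rfl
  -- the Picard ball `closedBall Y₀ 1 ⊆ {‖Y‖ ≤ ρ}`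
  have hball : ∀ Y ∈ closedBall Y₀ ((1 : ℝ≥0) : ℝ), ‖Y‖ ≤ ρ := by
    intro Y hY
    rw [mem_closedBall, dist_eq_norm] at hY
    calc ‖Y‖ = ‖(Y - Y₀) + Y₀‖ := by rw [sub_add_cancel]
      _ ≤ ‖Y - Y₀‖ + ‖Y₀‖ := norm_add_le _ _
      _ ≤ 1 + R := add_le_add (by simpa using hY) hY₀n
      _ = ρ := by rw [hρdef]; ring
  -- bound of the field on the ball
  set Lnn : ℝ≥0 := ⟨Lr, hLr⟩ with hLnn
  have hLc : (Lnn : ℝ) = Lr := rfl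
  have hFbound : ∀ Y ∈ closedBall Y₀ ((1 : ℝ≥0) : ℝ), ‖F Y‖ ≤ (Lnn : ℝ) := by
    intro Y hY
    have hYρ := hball Y hY
    rw [hLc]
    refine (norm_le hLr).2 fun n => ?_
    refine (hFb Y n).trans ?_
    rw [hLrdef]
    exact mul_le_mul_of_nonneg_left (pow_le_pow_left₀ (norm_nonneg _) hYρ 2) hC.le
  -- Lipschitz bound of the field on the ball
  have hK : (0 : ℝ) ≤ 2 * C * ρ := by positivity
  set Knn : ℝ≥0 := ⟨2 * C * ρ, hK⟩ with hKnn
  have hKc : (Knn : ℝ) = 2 * C * ρ := rfl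
  have hFlip : LipschitzOnWith Knn F (closedBall Y₀ ((1 : ℝ≥0) : ℝ)) := by
    refine LipschitzOnWith.of_dist_le_mul fun Y hY Z hZ => ?_
    have hYρ := hball Y hY
    have hZρ := hball Z hZ
    rw [dist_eq_norm, dist_eq_norm, hKc]
    have hd : ∀ k : ℤ, |Y k - Z k| ≤ ‖Y - Z‖ := fun k => by
      simpa only [BoundedContinuousFunction.coe_sub, Pi.sub_apply] using hcoord (Y - Z) k
    refine (norm_le (by positivity)).2 fun n => ?_
    simp only [BoundedContinuousFunction.coe_sub, Pi.sub_apply, hFapply, Real.norm_eq_abs]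
    have a1 := hcoord Y (n - 1); have a2 := hcoord Y n; have a3 := hcoord Y (n + 1)
    have b1 := hcoord Z (n - 1); have b2 := hcoord Z n; have b3 := hcoord Z (n + 1)
    have d1 := hd (n - 1); have d2 := hd n; have d3 := hd (n + 1)
    have hdn := norm_nonneg (Y - Z)
    -- `Λ (y² − z²) = Λ (y − z)(y + z)`
    have e1 : |Λ * Y (n - 1) ^ 2 - Λ * Z (n - 1) ^ 2| ≤ Λ * (‖Y - Z‖ * (ρ + ρ)) := by
      have : Λ * Y (n - 1) ^ 2 - Λ * Z (n - 1) ^ 2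
          = Λ * ((Y (n - 1) - Z (n - 1)) * (Y (n - 1) + Z (n - 1))) := by ring
      rw [this, abs_mul, abs_of_pos hΛ, abs_mul]
      refine mul_le_mul_of_nonneg_left ?_ hΛ.le
      refine mul_le_mul d1 ((abs_add_le _ _).trans (add_le_add (a1.trans hYρ) (b1.trans hZρ)))
        (abs_nonneg _) hdn
    -- `Λ⁻¹ (y y' − z z') = Λ⁻¹ ((y − z) y' + z (y' − z'))`
    have e2 : |Λ⁻¹ * Y n * Y (n + 1) - Λ⁻¹ * Z n * Z (n + 1)| ≤ Λ⁻¹ * (‖Y - Z‖ * ρ + ρ * ‖Y - Z‖) := by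
      have : Λ⁻¹ * Y n * Y (n + 1) - Λ⁻¹ * Z n * Z (n + 1)
          = Λ⁻¹ * ((Y n - Z n) * Y (n + 1) + Z n * (Y (n + 1) - Z (n + 1))) := by ring
      rw [this, abs_mul, abs_of_pos hΛi]
      refine mul_le_mul_of_nonneg_left ?_ hΛi.le
      refine (abs_add_le _ _).trans (add_le_add ?_ ?_)
      · rw [abs_mul]; exact mul_le_mul d2 (a3.trans hYρ) (abs_nonneg _) hdn
      · rw [abs_mul]; exact mul_le_mul (b2.trans hZρ) d3 (abs_nonneg _) hρ.le
    have : Λ * Y (n - 1) ^ 2 - Λ⁻¹ * Y n * Y (n + 1) - (Λ * Z (n - 1) ^ 2 - Λ⁻¹ * Z n * Z (n + 1))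
        = (Λ * Y (n - 1) ^ 2 - Λ * Z (n - 1) ^ 2)
          - (Λ⁻¹ * Y n * Y (n + 1) - Λ⁻¹ * Z n * Z (n + 1)) := by ring
    rw [this]
    calc |Λ * Y (n - 1) ^ 2 - Λ * Z (n - 1) ^ 2 - (Λ⁻¹ * Y n * Y (n + 1) - Λ⁻¹ * Z n * Z (n + 1))|
        ≤ |Λ * Y (n - 1) ^ 2 - Λ * Z (n - 1) ^ 2|
          + |Λ⁻¹ * Y n * Y (n + 1) - Λ⁻¹ * Z n * Z (n + 1)| := abs_sub _ _
      _ ≤ Λ * (‖Y - Z‖ * (ρ + ρ)) + Λ⁻¹ * (‖Y - Z‖ * ρ + ρ * ‖Y - Z‖) := add_le_add e1 e2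
      _ = (2 * C * ρ) * ‖Y - Z‖ := by rw [hCdef]; ring
  -- Picard–Lindelöf on `[-δ, δ]` about `t₀ = 0`, centre `Y₀`, radius `a = 1`, `r = 0`
  have hδI : (0 : ℝ) ∈ Icc (-δ) δ := ⟨by linarith, hδ.le⟩
  set T₀ : Icc (-δ) δ := ⟨0, hδI⟩ with hT₀
  have hPL : IsPicardLindelof (fun _ : ℝ => F) T₀ Y₀ (1 : ℝ≥0) (0 : ℝ≥0) Lnn Knn := by
    refine IsPicardLindelof.of_time_independent hFbound hFlip ?_
    have hmax : max (δ - ((T₀ : Icc (-δ) δ) : ℝ)) (((T₀ : Icc (-δ) δ) : ℝ) - -δ) = δ := by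
      rw [hT₀]; simp
    rw [hmax, hLc]
    simpa using hLδ
  obtain ⟨α, hα0, hα, hαball⟩ := exists_solution_mem_closedBall hPL (mem_closedBall_self le_rfl)
  have hα0' : α 0 = Y₀ := by simpa [hT₀] using hα0
  have hαn : ∀ t, ‖α t‖ ≤ ρ := fun t => hball (α t) (hαball t)
  -- the physical coordinates
  refine ⟨fun n t => (Λ ^ n)⁻¹ * α t n, fun n => ?_, fun n t ht => ?_, fun n t _ => ?_⟩
  · -- initial values
    show (Λ ^ n)⁻¹ * α 0 n = X₀ n
    rw [hα0']
    simp only [hY₀def, coe_ofNormedAddCommGroupDiscrete]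
    rw [inv_mul_cancel_left₀ (zpow_ne_zero n hΛne)]
  · -- the law at shell `n` on the open window
    have hαt : HasDerivAt α (F (α t)) t :=
      (hα t (Ioo_subset_Icc_self ht)).hasDerivAt (Icc_mem_nhds ht.1 ht.2)
    have hcoordDeriv : HasDerivAt (fun s => α s n) (F (α t) n) t := by
      have h := ((BoundedContinuousFunction.evalCLM ℝ n).hasFDerivAt.comp_hasDerivAt t hαt)
      simpa [Function.comp_def] using h
    have h := hcoordDeriv.const_mul ((Λ ^ n)⁻¹)
    show HasDerivAt (fun t => (Λ ^ n)⁻¹ * α t n)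
      (Λ ^ (n - 1) * ((Λ ^ (n - 1))⁻¹ * α t (n - 1)) ^ 2
        - Λ ^ n * ((Λ ^ n)⁻¹ * α t n) * ((Λ ^ (n + 1))⁻¹ * α t (n + 1))) t
    refine h.congr_deriv ?_
    rw [hFapply, zpow_sub_one₀ hΛne, zpow_add_one₀ hΛne]
    have hzn : Λ ^ n ≠ 0 := zpow_ne_zero n hΛne
    field_simp
  · -- regularity on the closed window
    show |Λ ^ n * ((Λ ^ n)⁻¹ * α t n)| ≤ R + 1
    rw [mul_inv_cancel_left₀ (zpow_ne_zero n hΛne)]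
    exact (hcoord (α t) n).trans (hαn t)

/-- **Local existence with non-negative data: a non-negative regular solution obeying the type-I
frame bound on `[0, δ)`.**  For `Λ > 1` and a non-negative datum with `Λⁿ X⁰ₙ ≤ R`, the local solution
of `dyadic_local_existence` is non-negative on `[0, δ)` (`dyadic_nonneg`) and every frame amplitude
obeys `0 ≤ ΛⁿXₙ(t)(δ − t) ≤ 2Λ²/(Λ−1)²` there (`frame_bound_of_nonneg_data` on the interval of
regularity `(−δ, δ)`).
[cite: Tao2016AveragedNS, §1.2, §4 Lemma 4.1 (4.8) with `m = 1`; Teschl2012 Thm. 2.2; elementary] -/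
theorem dyadic_local_existence_nonneg {Λ R : ℝ} (hΛ : 1 < Λ) (hR : 0 ≤ R) {X₀ : ℤ → ℝ}
    (hX₀ : ∀ n : ℤ, |Λ ^ n * X₀ n| ≤ R) (hpos : ∀ n : ℤ, 0 ≤ X₀ n) :
    ∃ δ : ℝ, 0 < δ ∧ δ = 1 / ((Λ + Λ⁻¹) * (R + 1) ^ 2 + 1) ∧
    ∃ X : ℤ → ℝ → ℝ, (∀ n : ℤ, X n 0 = X₀ n) ∧
      (∀ n : ℤ, ∀ t ∈ Ioo (-δ) δ,
        HasDerivAt (X n) (Λ ^ (n - 1) * X (n - 1) t ^ 2 - Λ ^ n * X n t * X (n + 1) t) t) ∧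
      (∀ n : ℤ, ∀ t ∈ Icc (-δ) δ, |Λ ^ n * X n t| ≤ R + 1) ∧
      (∀ n : ℤ, ∀ t ∈ Ico 0 δ, 0 ≤ X n t) ∧
      (∀ n : ℤ, ∀ t ∈ Ico 0 δ, Λ ^ n * X n t * (δ - t) ≤ 2 * Λ ^ 2 / (Λ - 1) ^ 2) := by
  have hΛ0 : 0 < Λ := by linarith
  set δ : ℝ := 1 / ((Λ + Λ⁻¹) * (R + 1) ^ 2 + 1) with hδdef
  have hδ : 0 < δ := by positivity
  obtain ⟨X, hX0, hlaw, hreg⟩ := dyadic_local_existence hΛ0 hR hX₀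
  have h0 : (0 : ℝ) ∈ Ioo (-δ) δ := ⟨by linarith, hδ⟩
  refine ⟨δ, hδ, rfl, X, hX0, hlaw, hreg, fun n t ht => ?_, fun n t ht => ?_⟩
  · exact dyadic_nonneg (N := n) hΛ0.le (fun k _ => hlaw k) h0
      (fun k _ => by rw [hX0 k]; exact hpos k) n le_rfl t ht
  · have hreg' : ∀ T', T' < δ → ∃ B : ℝ, ∀ k : ℤ, n - 1 ≤ k → ∀ t ∈ Ioo (-δ) T',
        |Λ ^ k * X k t| ≤ B :=
      fun T' hT' => ⟨R + 1, fun k _ t ht' => hreg k t ⟨ht'.1.le, (ht'.2.trans hT').le⟩⟩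
    exact (frame_bound_of_nonneg_data (N := n) hΛ (fun k _ => hlaw k) hreg' h0
      (fun k _ => by rw [hX0 k]; exact hpos k) le_rfl ht).2

end WakeRatchetDyadicCauchy

end Summit.NavierStokesRegularity.NavierStokesRegularity.Theorems

end
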